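import Summits.ABC.IUTFork.Cor312ThetaSideStrictM
import HarnessLib

/-!
# [IUTchIII] Corollary 3.12 at the M-LEVEL sharp setting of the datum's OWN Θ-ideles — the «(or =)» half, second part:
# the GLOBAL ASSEMBLY of nonarchimedean EXACTNESS `−|log(Θ)|(setting) = ↑(I.negLogThetaNonarch)` from the per-packet equality

PROOF-ONLY record file (D-0012; no definitions, no `Prop` facts) of the abc-iut cell (R2 S-chain team, seat abc-iut-s2-p8, gen 3;
branch C «abc ⇐ S», C-lead ruling C-R12 (e) «target #2′»; director's mint 2026-08-26T07:39:27Z, TARGET #2 «… ≤ ↑I.negLogTheta (or =)»).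
TAKES NO SIDE on [IUTchIII] Cor. 3.12.

abc-iut-w5-d166's assembly `negLogTheta_le_genuine_of_local_bounds` (`Cor312ThetaSideAssemblyM`, p438195) reduced the READ binder `hΘ`
to three LOCAL inputs (h∞), (hA) `thetaLocal ≤ orbitSumM`, (hlow); this seat's `Cor312ThetaSideStrictM` (p445327) ran it with the
archimedean summand `A := 0` (`≤ ↑negLogThetaNonarch`, hence `<` and `≠` the full number). THIS file is the assembly WITH EQUALITIES —
the shape that turns the per-packet EQUALITY (hA=) `thetaLocal_{i+1,u} = orbitSumM D r i u` (abc-iut-s2-p9's question (N1); upper half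
this seat's p440655, lower half abc-iut-s2-p9's generic `sum_content_hull_le_thetaLocal_untopD`, `Cor312ThetaLocalGeContentHull` p448133,
at the M setting) into the GLOBAL identity:

* §1 (generic, any `Cor312.Setting`): `finsum_thetaLocal_eq`, **`negLogTheta_eq_of_thetaLocal_eq`** — if at every label `j ∈ 𝔽_l^⋇` the local
  Θ-volume EQUALS `b` on a finite set `T′` of places of `ℚ` and vanishes off `T′`, then `−|log(Θ)| = ↑(Σ_{v_ℚ ∈ T′} (1/ℓ⋆)·Σ_i b)` (the
  R-twin of abc-iut-w5-d166's `negLogTheta_le_sum_add` with equalities, [IUTchIV] Thm. 1.10 Step (viii));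
* §2 (generic over the M-level index skeleton): **`negLogTheta_eq_negLogThetaNonarch_of_local_eq`** — (h∞) + (hA=) + (hlow) ⟹
  `P.negLogTheta = ↑(volumeInputOf D r).negLogThetaNonarch` (unit P6-ident `procAvg_orbitSumM_eq_negLogThetaLoc`, p437565; one place per prime);
* §3 at the sharp settings of the datum's own Θ-ideles: **`negLogTheta_settingMSharp_tOfIdeleData_eq_negLogThetaNonarch_of_local_eq (hAeq)`**,
  the summand-route twin at this seat's `settingPrVolSharpM` (p438078) and the `IsVolumeInputOf` form — (h∞)/(hlow) DISCHARGED (abc-iut-s2-p9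
  `thetaLocal_settingMSharp_arc`, abc-iut-w5-d166 `thetaLocal_settingMSharp_tOfIdeleData_eq_zero`), the ONE remaining binder being the per-packet
  equality (hA=), whose `≤` half is this seat's `thetaLocal_settingMSharp_tOfIdeleData_le_orbitSumM` (p440655) and whose `≥` half is the
  instantiation of p448133 at the M setting (abc-iut-s2-p9, in flight at filing time).

[cite: Mochizuki2012, IUTchIII Cor. 3.12 p. 173–174] [cite: Mochizuki2012, IUTchIV Thm. 1.10 Steps (v)–(viii) p. 27–31]
[cite: DupuyHilado2025, §1 (1.1), Def. 3.6.3, §4.11–4.12] [claim: Mochizuki2012, status: disputed] for every quoted construction.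
HONEST FRAMING: an identity between OUR typed `−|log(Θ)|` of OUR typed M-level setting and abc-iut-S2's DEFINED nonarchimedean number,
CONDITIONAL on the stated per-packet equality; nothing here asserts or denies [IUTchIII] Cor. 3.12 or takes a side on any author; typed ≠ proved;
instantiated ≠ endorsed.
-/

noncomputable section

open Set Function NumberField IsDedekindDomain
open scoped Classical

/-! ## §1. `−|log(Θ)|` from local EQUALITIES (generic) -/

namespace Summit.ABC.IUTFork.Cor312.Setting

open Thm311 Literature.IUT.LogThetaLattice

variable {T : ThetaIndex} {S : Situation T} (P : Setting S)

/-- **The global Θ-volume at one label from local equalities**: if the local Θ-volume at label `i+1` equals `b i v_ℚ` on `T′` and vanishes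
off `T′`, then `Σ_{v_ℚ} (thetaLocal).untopD 0 = Σ_{v_ℚ ∈ T′} b i v_ℚ` ([IUTchIII] Prop. 3.9 (iii): a finite sum). [claim: Mochizuki2012, status: disputed] -/
theorem finsum_thetaLocal_eq (Tset : Finset T.VQ) (b : Fin T.lstar → T.VQ → ℝ) (i : Fin T.lstar)
    (hzero : ∀ vQ : T.VQ, vQ ∉ Tset → P.thetaLocal (labelSucc i) vQ = ((0 : ℝ) : WithTop ℝ))
    (heq : ∀ vQ ∈ Tset, P.thetaLocal (labelSucc i) vQ = ((b i vQ : ℝ) : WithTop ℝ)) :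
    ∑ᶠ vQ : T.VQ, (P.thetaLocal (labelSucc i) vQ).untopD 0 = ∑ vQ ∈ Tset, b i vQ := by
  classical
  have hsupp : (Function.support fun vQ : T.VQ => (P.thetaLocal (labelSucc i) vQ).untopD 0) ⊆ (Tset : Set T.VQ) := by
    intro vQ hvQ
    by_contra hv
    apply hvQ
    show (P.thetaLocal (labelSucc i) vQ).untopD 0 = 0
    rw [hzero vQ hv, WithTop.untopD_coe]
  rw [finsum_eq_sum_of_support_subset _ hsupp]
  exact Finset.sum_congr rfl fun vQ hvQ => by rw [heq vQ hvQ, WithTop.untopD_coe]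

/-- **`−|log(Θ)| = ↑(Σ_{v_ℚ ∈ T′} (1/ℓ⋆)·Σ_i b i v_ℚ)` from local EQUALITIES** — the R-twin of abc-iut-w5-d166's `negLogTheta_le_sum_add`: if at
every label `j ∈ 𝔽_l^⋇` the local Θ-volume equals `b` on the finite set `T′` and vanishes off it, then `ThetaFinite` holds and the typed
`−|log(Θ)|` IS the procession-normalised place-sum of `b` ([IUTchIV] Thm. 1.10 Step (viii), place-first form).
[claim: Mochizuki2012, status: disputed] -/
theorem negLogTheta_eq_of_thetaLocal_eq (Tset : Finset T.VQ) (b : Fin T.lstar → T.VQ → ℝ)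
    (hzero : ∀ (i : Fin T.lstar) (vQ : T.VQ), vQ ∉ Tset → P.thetaLocal (labelSucc i) vQ = ((0 : ℝ) : WithTop ℝ))
    (heq : ∀ (i : Fin T.lstar), ∀ vQ ∈ Tset, P.thetaLocal (labelSucc i) vQ = ((b i vQ : ℝ) : WithTop ℝ)) :
    P.negLogTheta = ((∑ vQ ∈ Tset, (1 / (T.lstar : ℝ)) * ∑ i : Fin T.lstar, b i vQ : ℝ) : WithTop ℝ) := by
  have hfin : P.ThetaFinite := P.thetaFinite_of_thetaLocal_le Tset b hzero fun i vQ hvQ => (heq i vQ hvQ).le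
  unfold negLogTheta
  rw [if_pos hfin, ← processionNormalized_sum_comm]
  congr 2
  funext i
  exact P.finsum_thetaLocal_eq Tset b i (hzero i) (heq i)

end Summit.ABC.IUTFork.Cor312.Setting

namespace Summit.ABC.IUTFork.Thm311.Real

open Cor312 Cor312Vol Literature.IUT.LogThetaLattice Literature.IUT.LogVolume Literature.IUT.HodgeTheaters
  Literature.NumberTheory.NumberFields

variable {F K Fbar : Type} [Field F] [NumberField F] [Field K] [NumberField K] [Algebra F K]
  [Field Fbar] [Algebra F Fbar] [Algebra K Fbar] {E : WeierstrassCurve F} [E.IsElliptic] {l : ℕ}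
  {Pb : BadPlacePredicates K} (D : InitialThetaData F K Fbar E l Pb) (r : ThetaData.IdeleData D)

/-! ## §2. The assembly with equalities (generic over the M-level index skeleton) -/

section Generic

variable {S : Situation (thetaIndexOfInitial D)} (P : Cor312.Setting S)

/-- **G1-Θ ASSEMBLED at the M level, EXACT nonarchimedean form.** For ANY setting `P` of [IUTchIII] Cor. 3.12 over the index skeleton of
the initial Θ-data `D` and the genuine Θ-volume input of idele data `r`: if (h∞) the local Θ-volumes vanish at the archimedean place, (hA=)
EQUAL the orbit sums `orbitSumM D r i u` at every finite place and label, and (hlow) are nonnegative at the finite places outside the support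
`T(I)`, then `P.negLogTheta = ↑(volumeInputOf D r).negLogThetaNonarch` (abc-iut-w5-d166's unit P6-ident: the procession average of the orbit
sums at `u ∋ p` IS abc-iut-S2's `negLogThetaLoc p`; off `T(I)` the local volumes vanish, `thetaLocal_eq_zero_of_not_mem_support`).
[cite: Mochizuki2012, IUTchIV Thm. 1.10 Steps (v)–(viii) p. 27–31] [cite: DupuyHilado2025, Def. 3.6.3, §4.11–4.12] -/
theorem negLogTheta_eq_negLogThetaNonarch_of_local_eq
    (harc : ∀ (i : Fin (thetaIndexOfInitial D).lstar) (w : InfinitePlace ℚ),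
      P.thetaLocal (Cor312.Setting.labelSucc i) (Val.arc w) = ((0 : ℝ) : WithTop ℝ))
    (hAeq : ∀ (i : Fin (thetaIndexOfInitial D).lstar) (u : FinitePlace ℚ),
      P.thetaLocal (Cor312.Setting.labelSucc i) (Val.non u) = ((orbitSumM D r i u : ℝ) : WithTop ℝ))
    (hlow : ∀ (i : Fin (thetaIndexOfInitial D).lstar) (u : FinitePlace ℚ),
      ratChar u ∉ (ThetaData.volumeInputOf D r).supportPrimes →
        ((0 : ℝ) : WithTop ℝ) ≤ P.thetaLocal (Cor312.Setting.labelSucc i) (Val.non u)) :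
    P.negLogTheta = (((ThetaData.volumeInputOf D r).negLogThetaNonarch : ℝ) : WithTop ℝ) := by
  set I := ThetaData.volumeInputOf D r with hI
  -- the finite set of places of `ℚ` under the support, one per prime
  let φ : {q // q ∈ I.supportPrimes} → (thetaIndexOfInitial D).VQ :=
    fun q => Val.non (placeOfPrimeQ q.1 (I.prime_of_mem_supportPrimes q.2))
  have hφ : Function.Injective φ := by
    intro q q' h
    have h1 : placeOfPrimeQ q.1 (I.prime_of_mem_supportPrimes q.2) =
        placeOfPrimeQ q'.1 (I.prime_of_mem_supportPrimes q'.2) := Sum.inr_injective h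
    apply Subtype.ext
    rw [← ratChar_placeOfPrimeQ q.1 (I.prime_of_mem_supportPrimes q.2), h1,
      ratChar_placeOfPrimeQ q'.1 (I.prime_of_mem_supportPrimes q'.2)]
  let Tset : Finset (thetaIndexOfInitial D).VQ := Finset.univ.image φ
  -- the local values: orbit sums at finite places, `0` at the archimedean place
  let b : Fin (thetaIndexOfInitial D).lstar → (thetaIndexOfInitial D).VQ → ℝ := fun i vQ =>
    match vQ with
    | .inr u => orbitSumM D r i u
    | .inl _ => 0
  have heq : ∀ (i : Fin (thetaIndexOfInitial D).lstar), ∀ vQ ∈ Tset,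
      P.thetaLocal (Cor312.Setting.labelSucc i) vQ = ((b i vQ : ℝ) : WithTop ℝ) := by
    intro i vQ hvQ
    obtain ⟨q, -, rfl⟩ := Finset.mem_image.mp hvQ
    exact hAeq i _
  have hzero : ∀ (i : Fin (thetaIndexOfInitial D).lstar) (vQ : (thetaIndexOfInitial D).VQ), vQ ∉ Tset →
      P.thetaLocal (Cor312.Setting.labelSucc i) vQ = ((0 : ℝ) : WithTop ℝ) := by
    intro i vQ hvQ
    rcases vQ with w | u
    · exact harc i w
    · have hu : ratChar u ∉ I.supportPrimes := by
        intro hmem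
        apply hvQ
        refine Finset.mem_image.mpr ⟨⟨ratChar u, hmem⟩, Finset.mem_univ _, ?_⟩
        show Val.non (placeOfPrimeQ (ratChar u) _) = Val.non u
        rw [placeOfPrimeQ_ratChar u]
      exact thetaLocal_eq_zero_of_not_mem_support D r P u hu (fun i' => (hAeq i' u).le) (fun i' => hlow i' u hu) i
  have hmain := P.negLogTheta_eq_of_thetaLocal_eq Tset b hzero heq
  -- the place sum of the averaged orbit sums is the nonarchimedean part of the genuine number
  have hsum : (∑ vQ ∈ Tset, (1 / ((thetaIndexOfInitial D).lstar : ℝ)) * ∑ i : Fin (thetaIndexOfInitial D).lstar, b i vQ) =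
      I.negLogThetaNonarch := by
    rw [Finset.sum_image fun q _ q' _ h => hφ h, ThetaVolumeInput.negLogThetaNonarch,
      ← Finset.sum_attach I.supportPrimes]
    refine Finset.sum_congr rfl fun q _ => ?_
    show (1 / ((thetaIndexOfInitial D).lstar : ℝ)) *
        ∑ i, orbitSumM D r i (placeOfPrimeQ q.1 (I.prime_of_mem_supportPrimes q.2)) = I.negLogThetaLoc q.1
    rw [procAvg_orbitSumM_eq_negLogThetaLoc, ratChar_placeOfPrimeQ]
  rw [hsum] at hmain
  exact hmain

end Generic

/-! ## §3. At the sharp settings of the datum's own Θ-ideles: `= ↑negLogThetaNonarch` from the per-packet equality (hA=) -/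

section Setting

variable {logvK : PadicLogsVal K} (hlog : LogvAnalyticVal logvK)
  (tq : ∀ (u : FinitePlace ℚ) (x : (thetaIndexOfInitial D).Fibre (Val.non u)),
    kOfM D (ratChar u) u (natCast_ratChar_mem u) x)
  (M : Type) [Field M] [NumberField M]
  (archPk : ∀ (j : (thetaIndexOfInitial D).Label) (vQ : (thetaIndexOfInitial D).VQ),
    Set ((logShellsOfInitialDH D logvK).Packet j vQ))
  (archSub : ∀ (j : (thetaIndexOfInitial D).Label) (v : (thetaIndexOfInitial D).V),
    Set ((logShellsOfInitialDH D logvK).Packet j ((thetaIndexOfInitial D).over v)))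
  (Ψ : ℤ → ∀ v : (thetaIndexOfInitial D).V, v ∈ (thetaIndexOfInitial D).Vbad →
    Set ((logShellsOfInitialDH D logvK).StarPacket v))
  (act : ℤ → ∀ v : (thetaIndexOfInitial D).V, v ∈ (thetaIndexOfInitial D).Vbad →
    (logShellsOfInitialDH D logvK).StarPacket v → Module.End ℚ ((logShellsOfInitialDH D logvK).StarPacket v))
  (Mmod : ℤ → ∀ j : (thetaIndexOfInitial D).LabelStar, Set ((logShellsOfInitialDH D logvK).GlobalPacket j.1))
  (region : ℤ → ∀ j : (thetaIndexOfInitial D).LabelStar, FinDivisor M → ∀ vQ : (thetaIndexOfInitial D).VQ,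
    Set ((logShellsOfInitialDH D logvK).Packet j.1 vQ))
  (n : ℤ) {HT : Type} {LogLink : HT → HT → Type} {IsFull : ∀ {s t : HT}, LogLink s t → Prop}
  (lat : LGPGaussianLogThetaLattice LogLink IsFull)
  {Frd : Type} {IsoF : Frd → Frd → Type} {Ob : Frd → Type} {realify : Frd → Frd} {Strip : Type}
  {IsoS : Strip → Strip → Type}
  {Mv : ∀ v : (thetaIndexOfInitial D).V, v ∈ (thetaIndexOfInitial D).Vbad → Type} [∀ v h, Monoid (Mv v h)]
  (sig : GlobalLGPFrobenioidSignature (thetaIndexOfInitial D).lstar (thetaIndexOfInitial D).V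
    (· ∈ (thetaIndexOfInitial D).Vbad) Frd IsoF Ob realify Strip IsoS Mv)
  (split : SplittingMonoids Mv) {ObΔ : Type}
  {N : ∀ v : (thetaIndexOfInitial D).V, v ∈ (thetaIndexOfInitial D).Vbad → Type} [∀ v h, Monoid (N v h)]
  (qData : QPilotData ObΔ N)
  (htq0 : ∀ u x, tq u x ≠ 0) (Sq : Finset (FinitePlace ℚ))
  (htq1 : ∀ (u : FinitePlace ℚ) (x : (thetaIndexOfInitial D).Fibre (Val.non u)), u ∉ Sq → ‖tq u x‖ = 1)

/-- **Nonarchimedean EXACTNESS at the frames-route M-level sharp setting of the datum's own Θ-ideles, modulo the per-packet equality**: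
IF at every label `i+1` and finite place `u` the local Θ-volume of `settingMSharp … (tOfIdeleData D r) …` EQUALS `orbitSumM D r i u` (its `≤`
half is this seat's `thetaLocal_settingMSharp_tOfIdeleData_le_orbitSumM`, p440655; its `≥` half is abc-iut-s2-p9's content-hull lower bound
instantiated at the M setting), THEN `−|log(Θ)|(setting) = ↑(volumeInputOf D r).negLogThetaNonarch` — (h∞) and (hlow) are theorems here
(abc-iut-s2-p9 `thetaLocal_settingMSharp_arc`, abc-iut-w5-d166 `thetaLocal_settingMSharp_tOfIdeleData_eq_zero`).
[cite: Mochizuki2012, IUTchIII Cor. 3.12 p. 173–174] -/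
theorem negLogTheta_settingMSharp_tOfIdeleData_eq_negLogThetaNonarch_of_local_eq
    (hAeq : ∀ (i : Fin (thetaIndexOfInitial D).lstar) (u : FinitePlace ℚ),
      (settingMSharp D hlog M archPk archSub Ψ act Mmod region n lat sig split qData (tOfIdeleData D r) tq htq0 Sq
          htq1).thetaLocal (Setting.labelSucc i) (Val.non u) = ((orbitSumM D r i u : ℝ) : WithTop ℝ)) :
    (settingMSharp D hlog M archPk archSub Ψ act Mmod region n lat sig split qData (tOfIdeleData D r) tq htq0 Sq htq1).negLogTheta =
      (((ThetaData.volumeInputOf D r).negLogThetaNonarch : ℝ) : WithTop ℝ) :=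
  negLogTheta_eq_negLogThetaNonarch_of_local_eq D r _
    (fun i w => thetaLocal_settingMSharp_arc D hlog M archPk archSub Ψ act Mmod region n lat sig split qData (tOfIdeleData D r)
      tq htq0 Sq htq1 (Setting.labelSucc i) w)
    hAeq
    (fun i u hu => (thetaLocal_settingMSharp_tOfIdeleData_eq_zero D hlog r M archPk archSub Ψ act Mmod region n lat sig split
      qData tq htq0 Sq htq1 i u hu).symm.le)

/-- **Summand route**: under the same per-packet equality (stated at the frames route — the two routes have the same local terms,
abc-iut-w4-d013's identity `thetaLocal_settingMSharp_eq_settingPrVolSharpM`), `−|log(Θ)|(settingPrVolSharpM … (tOfIdeleData D r) …) =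
↑(volumeInputOf D r).negLogThetaNonarch` (this seat's `settingPrVolSharpM`, p438078). [cite: Mochizuki2012, IUTchIII Cor. 3.12 p. 173–174] -/
theorem negLogTheta_settingPrVolSharpM_tOfIdeleData_eq_negLogThetaNonarch_of_local_eq
    (hAeq : ∀ (i : Fin (thetaIndexOfInitial D).lstar) (u : FinitePlace ℚ),
      (settingMSharp D hlog M archPk archSub Ψ act Mmod region n lat sig split qData (tOfIdeleData D r) tq htq0 Sq
          htq1).thetaLocal (Setting.labelSucc i) (Val.non u) = ((orbitSumM D r i u : ℝ) : WithTop ℝ)) :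
    (settingPrVolSharpM D hlog (tOfIdeleData D r) tq M archPk archSub Ψ act Mmod region n lat sig split qData htq0 Sq
        htq1).negLogTheta = (((ThetaData.volumeInputOf D r).negLogThetaNonarch : ℝ) : WithTop ℝ) := by
  rw [← negLogTheta_settingMSharp_eq_settingPrVolSharpM]
  exact negLogTheta_settingMSharp_tOfIdeleData_eq_negLogThetaNonarch_of_local_eq D r hlog tq M archPk archSub Ψ act Mmod region n lat
    sig split qData htq0 Sq htq1 hAeq

/-- **For a volume input `I` of `D`** (`IsVolumeInputOf D I`; abc-iut-w5-d033 `eq_volumeInputOf_ideleDataOf`): at the frames-route M-level sharp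
setting of `I`'s own Θ-ideles, the per-packet equality gives `−|log(Θ)| = ↑I.negLogThetaNonarch` — the READ binder `hΘ : … ≤ ↑I.negLogTheta`
of `Conditional/AbcOfS*.lean` is then sharp up to EXACTLY the archimedean closed form `((l+5)/4)·log π`.
[cite: Mochizuki2012, IUTchIII Cor. 3.12 p. 173–174] -/
theorem negLogTheta_settingMSharp_eq_negLogThetaNonarch_of_isVolumeInputOf_of_local_eq {I : ThetaVolumeInput (fieldOfModuli E) K}
    (hI : ThetaData.IsVolumeInputOf D I)
    (hAeq : ∀ (i : Fin (thetaIndexOfInitial D).lstar) (u : FinitePlace ℚ),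
      (settingMSharp D hlog M archPk archSub Ψ act Mmod region n lat sig split qData (tOfIdeleData D (ideleDataOf D hI)) tq htq0 Sq
          htq1).thetaLocal (Setting.labelSucc i) (Val.non u) = ((orbitSumM D (ideleDataOf D hI) i u : ℝ) : WithTop ℝ)) :
    (settingMSharp D hlog M archPk archSub Ψ act Mmod region n lat sig split qData (tOfIdeleData D (ideleDataOf D hI)) tq htq0
        Sq htq1).negLogTheta = ((I.negLogThetaNonarch : ℝ) : WithTop ℝ) := by
  rw [congrArg ThetaVolumeInput.negLogThetaNonarch (eq_volumeInputOf_ideleDataOf D hI)]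
  exact negLogTheta_settingMSharp_tOfIdeleData_eq_negLogThetaNonarch_of_local_eq D (ideleDataOf D hI) hlog tq M archPk archSub Ψ act
    Mmod region n lat sig split qData htq0 Sq htq1 hAeq

end Setting

end Summit.ABC.IUTFork.Thm311.Real

end
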